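import Summits.ResolutionOfSingularities.ResolutionOfSingularities.Theorems.WeightedInvariantIota3Regimes
import Summits.ResolutionOfSingularities.ResolutionOfSingularities.Theorems.WeightedInvariantP3bDrop
import Literature.AlgebraicGeometry.Resolution.AlterationsBoundarySmoothLocus
import HarnessLib

/-!
# The σ letter in the POINTWISE cases: the DVR/field reading value, and point-centre positions

W4.3 hypersurface-centre programme, crux `HypersurfaceCentreConstruction` (stmt-ResolutionOfSingularities-19897), local engine
(stmt-ResolutionOfSingularities-8899); res-L1-w43-plan-1 RULING gen 11 #3 (3) «(c7σ)/(c10σ) pointwise cases (dim ≤ 2, DIV, isolated)»,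
DELIVERABLE 1 (res-type-073).  The P3 invariant of record is `iotaFlat = (ν ; ε ; σ-read-along-the-cylinder)` (res-D-pv-061, p529577):
`iotaLex _ iotaOrdEps (ContactCylinder.iotaCylinder iotaOrdEps iotaSigma)`, where the σ-block is `iotaSigma` (p528355) read at the
localisation at the generic prime `P₀ = topStratumPrime iotaOrdEps S f` of the top `(ν, ε)`-stratum.

Contents (namespace `…LocalEngine.Iota3`):
* **Reading value on a DVR / field.**  A local ring with PRINCIPAL maximal ideal has no two-flag (`not_isTwoFlag_of_maximalIdeal_eq_span_singleton`),
  so no flag reaches anything, `sigmaRatioNat f = 0`, `levelSet f = ∅`, and `iotaSigma S f = ω` (`σ₁ = 0`, level letter at TOP):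
  `iotaSigma_eq_omega0_of_maximalIdeal_eq_span_singleton`; in particular on every regular local ring of Krull dimension `≤ 1`
  (`iotaSigma_eq_omega0_of_ringKrullDim_le_one`).  This is the σ-value of the reading at a DIVISORIAL position (reading ring `S_(π)`, a
  DVR): `iotaCylinder_iotaSigma_eq_omega0_of_isDivisorialPosition`.
* **Point-centre positions have no `(ν, ε)`-tie off `𝔪`.**  If `P₀ = 𝔪` (`IsPointCentrePosition`; isolated and crossing positions, part 1
  of (o38)) then every prime of the top `(ν, ε)`-stratum is `𝔪` (`eq_maximalIdeal_of_mem_topStratum_of_isPointCentrePosition`), so at a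
  prime `𝔭 ≠ 𝔪` of a regular local ring the pair `(ν, ε)` DROPS STRICTLY (`iotaOrdEps_localization_lt_of_isPointCentrePosition`, from
  res-type-078's (c7) for `iotaOrdEps`, p528033) and hence so does `iotaFlat` (`iotaFlat_localization_lt_of_isPointCentrePosition`);
  with the value at `𝔭 = 𝔪` unchanged ((c6) iso-invariance) this is the generization clause (c7) for `iotaFlat` AT POINT-CENTRE POSITIONS
  in every dimension: `iotaFlat_localization_le_of_isPointCentrePosition` — the σ letter is never consulted there.

All statements are folklore commutative algebra about OUR predicates ([OURS] defs of p528355 / p530450 / p529577); nothing here is a cited theorem.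
Reference for the programme: [cite: AbramovichTemkinWlodarczyk2024, §5].
-/

open IsLocalRing Literature.AlgebraicGeometry.Resolution
open Summit.ResolutionOfSingularities.ResolutionOfSingularities.Theorems

set_option linter.dupNamespace false -- mandated namespace of this single-conjunct summit

namespace Summit.ResolutionOfSingularities.ResolutionOfSingularities.Cruxes.HypersurfaceCentreConstruction.LocalEngine

namespace Iota3

variable {S : Type} [CommRing S]

/-! ## No two-flag when the maximal ideal is principal -/

/-- A local ring with principal maximal ideal `𝔪 = (π)` has no two-flag: two multiples of `π` are never independent modulo `𝔪²`.
[folklore] -/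
theorem not_isTwoFlag_of_maximalIdeal_eq_span_singleton [IsLocalRing S] {π : S} (h : maximalIdeal S = Ideal.span {π}) (g₁ g₂ : S) :
    ¬ IsTwoFlag g₁ g₂ := by
  intro hF
  have hπ : π ∈ maximalIdeal S := h ▸ Ideal.mem_span_singleton_self π
  obtain ⟨a, ha⟩ : ∃ a, a * π = g₁ := Ideal.mem_span_singleton'.mp (h ▸ hF.1)
  obtain ⟨b, hb⟩ : ∃ b, b * π = g₂ := Ideal.mem_span_singleton'.mp (h ▸ hF.2.1)
  have hcomb : b * g₁ + (-a) * g₂ ∈ maximalIdeal S ^ 2 := by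
    have h0 : b * g₁ + (-a) * g₂ = 0 := by rw [← ha, ← hb]; ring
    rw [h0]
    exact zero_mem _
  have ha𝔪 : a ∈ maximalIdeal S := by simpa using (hF.2.2 b (-a) hcomb).2
  apply hF.left_not_mem_sq
  rw [← ha, pow_two]
  exact Ideal.mul_mem_mul ha𝔪 hπ

/-- … so no flag reaches any level. [folklore] -/
theorem not_flagReaches_of_maximalIdeal_eq_span_singleton [IsLocalRing S] {π : S} (h : maximalIdeal S = Ideal.span {π})
    (f : S) (ν q r₁ r₂ : ℕ) : ¬ FlagReaches f ν q r₁ r₂ :=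
  fun ⟨g₁, g₂, hF, _⟩ => not_isTwoFlag_of_maximalIdeal_eq_span_singleton h g₁ g₂ hF

/-- … so the scaled ratio letter is `0` (supremum of the empty set). [folklore] -/
theorem sigmaRatioNat_eq_zero_of_maximalIdeal_eq_span_singleton [IsLocalRing S] {π : S} (h : maximalIdeal S = Ideal.span {π})
    (f : S) : sigmaRatioNat f = 0 := by
  unfold sigmaRatioNat
  have hempty : {m : ℕ | ∃ q r₁ r₂ : ℕ, AdmissibleTriple q r₁ r₂ ∧ FlagReaches f (adicOrder f).toNat q r₁ r₂ ∧
      m * r₂ ≤ ratioScale (adicOrder f).toNat * r₁} = ∅ := by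
    ext m
    simp only [Set.mem_setOf_eq, Set.mem_empty_iff_false, iff_false, not_exists, not_and]
    exact fun q r₁ r₂ _ hR => absurd hR (not_flagReaches_of_maximalIdeal_eq_span_singleton h f _ q r₁ r₂)
  rw [hempty, csSup_empty]
  rfl

/-- … and the level set is empty. [folklore] -/
theorem levelSet_eq_empty_of_maximalIdeal_eq_span_singleton [IsLocalRing S] {π : S} (h : maximalIdeal S = Ideal.span {π}) (f : S) :
    levelSet f = ∅ := by
  ext m
  simp only [levelSet, Set.mem_setOf_eq, Set.mem_empty_iff_false, iff_false, not_exists, not_and]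
  exact fun q r₁ r₂ _ hR => absurd hR (not_flagReaches_of_maximalIdeal_eq_span_singleton h f _ q r₁ r₂)

/-- **The σ letter on a local ring with principal maximal ideal reads `ω`**: `σ₁ = 0` and the level letter is at TOP (empty level set).
This is the value of every DVR / field reading. [folklore] -/
theorem iotaSigma_eq_omega0_of_maximalIdeal_eq_span_singleton [IsLocalRing S] {π : S} (h : maximalIdeal S = Ideal.span {π}) (f : S) :
    iotaSigma S f = Ordinal.omega0 := by
  show (Ordinal.omega0 + 1) * iotaSigmaRatio S f + iotaSigmaLevel S f = Ordinal.omega0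
  rw [iotaSigmaRatio_eq, sigmaRatioNat_eq_zero_of_maximalIdeal_eq_span_singleton h, Nat.cast_zero, mul_zero, zero_add,
    iotaSigmaLevel_eq_omega0]
  rw [levelSet_eq_empty_of_maximalIdeal_eq_span_singleton h]
  simp

/-- A regular local ring of Krull dimension `≤ 1` (a field or a DVR) has principal maximal ideal. [folklore] -/
theorem exists_maximalIdeal_eq_span_singleton_of_ringKrullDim_le_one [IsRegularLocalRing S] (hdim : ringKrullDim S ≤ 1) :
    ∃ π : S, maximalIdeal S = Ideal.span {π} := by
  haveI := isDomain_of_isRegularLocalRing S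
  by_cases h0 : maximalIdeal S = ⊥
  · exact ⟨0, by rw [h0, eq_comm, Ideal.span_singleton_eq_bot]⟩
  · have hh : ((maximalIdeal S).height : WithBot ℕ∞) ≤ 1 := by
      rw [IsLocalRing.maximalIdeal_height_eq_ringKrullDim]
      exact hdim
    have hh' : (maximalIdeal S).height ≤ 1 := by
      rw [← WithBot.coe_le_coe, WithBot.coe_one]
      exact hh
    have hne : (maximalIdeal S).height ≠ 0 := by
      rw [Ne, Ideal.height_eq_zero_iff_eq_bot]
      exact h0
    have h1 : (maximalIdeal S).height = 1 := le_antisymm hh' (Order.one_le_iff_ne_zero.mpr hne)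
    have hdim1 : ringKrullDim S = 1 := by
      rw [← IsLocalRing.maximalIdeal_height_eq_ringKrullDim, h1]
      rfl
    exact exists_maximalIdeal_eq_span_singleton_of_ringKrullDim_eq_one hdim1

/-- **On a regular local ring of Krull dimension `≤ 1` the σ letter reads `ω`**, for every `f`. [folklore] -/
theorem iotaSigma_eq_omega0_of_ringKrullDim_le_one [IsRegularLocalRing S] (hdim : ringKrullDim S ≤ 1) (f : S) :
    iotaSigma S f = Ordinal.omega0 := by
  obtain ⟨π, hπ⟩ := exists_maximalIdeal_eq_span_singleton_of_ringKrullDim_le_one hdim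
  exact iotaSigma_eq_omega0_of_maximalIdeal_eq_span_singleton hπ f

/-! ## The divisorial reading -/

/-- At a DIVISORIAL position of a regular local ring of dimension `≤ 3` (`0 ≠ f ∈ 𝔪`) the reading ring `S_{P₀}`, `P₀ = (π)` the generic
prime of the top `(ν, ε)`-stratum, is regular of Krull dimension `≤ 1`. [folklore] -/
theorem ringKrullDim_localization_topStratumPrime_le_one_of_isDivisorialPosition [IsRegularLocalRing S] (hdim : ringKrullDim S ≤ 3)
    {f : S} (hf0 : f ≠ 0) (hf : f ∈ maximalIdeal S) (h : IsDivisorialPosition S f)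
    [hP : (ContactCylinder.topStratumPrime iotaOrdEps S f).IsPrime] :
    ringKrullDim (Localization.AtPrime (ContactCylinder.topStratumPrime iotaOrdEps S f)) ≤ 1 := by
  haveI := isDomain_of_isRegularLocalRing S
  obtain ⟨c, π, -, -, -, -, hPeq⟩ := exists_eq_unit_mul_pow_of_isDivisorialPosition hdim hf0 hf h
  rw [IsLocalization.AtPrime.ringKrullDim_eq_height (ContactCylinder.topStratumPrime iotaOrdEps S f)
    (Localization.AtPrime (ContactCylinder.topStratumPrime iotaOrdEps S f)), ← WithBot.coe_one, WithBot.coe_le_coe]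
  have hmin : ContactCylinder.topStratumPrime iotaOrdEps S f ∈ (Ideal.span {π}).minimalPrimes := by
    rw [← hPeq, Ideal.minimalPrimes_eq_subsingleton_self]
    exact Set.mem_singleton _
  exact Ideal.height_le_one_of_isPrincipal_of_mem_minimalPrimes (Ideal.span {π}) _ hmin

/-- The generic prime of the top `(ν, ε)`-stratum at a divisorial position is prime. [folklore] -/
theorem isPrime_topStratumPrime_of_isDivisorialPosition [IsRegularLocalRing S] (hdim : ringKrullDim S ≤ 3) {f : S} (hf0 : f ≠ 0)
    (hf : f ∈ maximalIdeal S) (h : IsDivisorialPosition S f) : (ContactCylinder.topStratumPrime iotaOrdEps S f).IsPrime := by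
  haveI := isDomain_of_isRegularLocalRing S
  obtain ⟨c, π, -, hπ, hπ2, -, hPeq⟩ := exists_eq_unit_mul_pow_of_isDivisorialPosition hdim hf0 hf h
  rw [hPeq, Ideal.span_singleton_prime (IsRegularLocalRing.prime_of_not_mem_sq hπ hπ2).ne_zero]
  exact IsRegularLocalRing.prime_of_not_mem_sq hπ hπ2

/-- **At a divisorial position the σ-block of `iotaFlat` reads `ω`**: the cylinder reading of `iotaSigma` along the top
`(ν, ε)`-stratum `V(π)` is `σ(S_(π), f) = ω` (a DVR has no two-flag). [folklore] -/
theorem iotaCylinder_iotaSigma_eq_omega0_of_isDivisorialPosition [IsRegularLocalRing S] (hdim : ringKrullDim S ≤ 3) {f : S}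
    (hf0 : f ≠ 0) (hf : f ∈ maximalIdeal S) (h : IsDivisorialPosition S f) :
    ContactCylinder.iotaCylinder iotaOrdEps iotaSigma S f = Ordinal.omega0 := by
  haveI := isPrime_topStratumPrime_of_isDivisorialPosition hdim hf0 hf h
  rw [ContactCylinder.iotaCylinder_eq_iotaAtPrime, ContactCylinder.iotaAtPrime_def]
  exact iotaSigma_eq_omega0_of_ringKrullDim_le_one
    (ringKrullDim_localization_topStratumPrime_le_one_of_isDivisorialPosition hdim hf0 hf h) _

/-! ## Point-centre positions: no `(ν, ε)`-tie off the closed point -/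

/-- At a point-centre position (`P₀ = 𝔪`) every prime of the top `(ν, ε)`-stratum is the maximal ideal. [folklore] -/
theorem eq_maximalIdeal_of_mem_topStratum_of_isPointCentrePosition [IsLocalRing S] {f : S} (h : IsPointCentrePosition S f)
    {𝔭 : PrimeSpectrum S} (h𝔭 : 𝔭 ∈ ContactCylinder.topStratum iotaOrdEps S f) : 𝔭.asIdeal = maximalIdeal S := by
  have hle : ContactCylinder.topStratumPrime iotaOrdEps S f ≤ 𝔭.asIdeal := by
    unfold ContactCylinder.topStratumPrime
    exact iInf₂_le 𝔭 h𝔭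
  rw [show ContactCylinder.topStratumPrime iotaOrdEps S f = maximalIdeal S from h] at hle
  exact ((IsLocalRing.maximalIdeal.isMaximal S).eq_of_le 𝔭.isPrime.ne_top hle).symm

/-- **At a point-centre position of a regular local ring the pair `(ν, ε)` drops strictly at every prime `𝔭 ≠ 𝔪`** ((c7) for
`iotaOrdEps`, res-type-078 p528033, plus the previous lemma). [folklore] -/
theorem iotaOrdEps_localization_lt_of_isPointCentrePosition [IsRegularLocalRing S] {f : S} (h : IsPointCentrePosition S f)
    (𝔭 : Ideal S) [𝔭.IsPrime] (hne : 𝔭 ≠ maximalIdeal S) :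
    iotaOrdEps (Localization.AtPrime 𝔭) (algebraMap S (Localization.AtPrime 𝔭) f) < iotaOrdEps S f := by
  refine lt_of_le_of_ne (iotaOrdEps_generizationMonotone S 𝔭 f) fun heq => hne ?_
  exact eq_maximalIdeal_of_mem_topStratum_of_isPointCentrePosition h (𝔭 := ⟨𝔭, inferInstance⟩)
    ((ContactCylinder.mem_topStratum_iff iotaOrdEps S f _).mpr heq)

/-- … hence `iotaFlat` drops strictly at every prime `𝔭 ≠ 𝔪` of a point-centre position (first block of the lexicographic nesting).
[folklore] -/
theorem iotaFlat_localization_lt_of_isPointCentrePosition [IsRegularLocalRing S] {f : S} (h : IsPointCentrePosition S f)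
    (𝔭 : Ideal S) [𝔭.IsPrime] (hne : 𝔭 ≠ maximalIdeal S) :
    iotaFlat (Localization.AtPrime 𝔭) (algebraMap S (Localization.AtPrime 𝔭) f) < iotaFlat S f :=
  (iotaFlat_lt_iff _ _ _ _).mpr (Or.inl (iotaOrdEps_localization_lt_of_isPointCentrePosition h 𝔭 hne))

/-- **(c7) for `iotaFlat` at point-centre positions, every dimension**: `iotaFlat (S_𝔭) (f/1) ≤ iotaFlat S f` for every prime `𝔭`
— strict off `𝔪`, equality at `𝔪` by (c6) iso-invariance of `iotaFlat`.  The σ letter is never consulted. [folklore] -/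
theorem iotaFlat_localization_le_of_isPointCentrePosition [IsRegularLocalRing S] {f : S} (h : IsPointCentrePosition S f)
    (𝔭 : Ideal S) [𝔭.IsPrime] :
    iotaFlat (Localization.AtPrime 𝔭) (algebraMap S (Localization.AtPrime 𝔭) f) ≤ iotaFlat S f := by
  by_cases hne : 𝔭 = maximalIdeal S
  · subst hne
    exact (LocalGameEFT4SDimOne.iota_localization_maximalIdeal_eq iotaFlat iotaFlat_isoInvariant f).le
  · exact (iotaFlat_localization_lt_of_isPointCentrePosition h 𝔭 hne).le

/-- (c7) for `iotaFlat` at an ISOLATED position (`f ∈ 𝔪`). [folklore] -/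
theorem iotaFlat_localization_le_of_isIsolatedPosition [IsRegularLocalRing S] {f : S} (hf : f ∈ maximalIdeal S)
    (h : IsIsolatedPosition S f) (𝔭 : Ideal S) [𝔭.IsPrime] :
    iotaFlat (Localization.AtPrime 𝔭) (algebraMap S (Localization.AtPrime 𝔭) f) ≤ iotaFlat S f :=
  iotaFlat_localization_le_of_isPointCentrePosition (isPointCentrePosition_of_isIsolatedPosition hf h) 𝔭

/-- (c7) for `iotaFlat` at a CROSSING position of a regular local ring of dimension `≤ 3` (`0 ≠ f ∈ 𝔪`). [folklore] -/
theorem iotaFlat_localization_le_of_isCrossingPosition [IsRegularLocalRing S] (hdim : ringKrullDim S ≤ 3) {f : S} (hf0 : f ≠ 0)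
    (hf : f ∈ maximalIdeal S) (h : IsCrossingPosition S f) (𝔭 : Ideal S) [𝔭.IsPrime] :
    iotaFlat (Localization.AtPrime 𝔭) (algebraMap S (Localization.AtPrime 𝔭) f) ≤ iotaFlat S f :=
  iotaFlat_localization_le_of_isPointCentrePosition (isPointCentrePosition_of_isCrossingPosition hdim hf0 hf h) 𝔭

end Iota3

end Summit.ResolutionOfSingularities.ResolutionOfSingularities.Cruxes.HypersurfaceCentreConstruction.LocalEngine
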